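import Summits.HodgeConjecture.HodgeConjecture.Theorems.MarkmanPartnerTransportFiniteMorphismTransport
import Summits.HodgeConjecture.HodgeConjecture.Theorems.MarkmanPartnerTransportPicardThreeK3SquaresKugaSatakePairPresentation
import Literature.AlgebraicGeometry.Motives.HodgeStructureStrongCMIsotypic

/-!
# Route MarkmanPartnerTransport · crux `PicardThreeK3Squares` (stmt-HodgeConjecture-19652) —
# programme «ISOGENY DATUM», brick 2: `T(Z) = f^* T(X)` for a morphism `f : Z ⟶ X` of smooth
# projective surfaces with `p_g(Z) = p_g(X) = 1` and `f^*` injective (Schur's lemma)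

Brick 1 (`…FiniteMorphismTransport`) gave `f^* T(X) ⊆ T(Z)` for the cup-transcendental subspaces
`T = NS^⊥ ⊗ ℂ` of any morphism of smooth projective surfaces, and the multiplier of `f₊` on `T(Z)`
GRANTED the reverse inclusion `T(Z) ⊆ f^* T(X)`. This file proves the reverse inclusion when both
surfaces have geometric genus one (their `(2,0)`-classes form a line — e.g. a K3 surface and a blow-up
of a K3 surface) and `f^*` is injective on `H²` (e.g. `f` of non-zero cohomological degree,
`FiniteMorphism.map_injective_of_deg`):

* `transcendentalSubspace_le_map_of_twoZero_lines` — **`T(Z) ⊆ f^* T(X)`**;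
* `transcendentalSubspace_eq_map_of_twoZero_lines` — **`T(Z) = f^* T(X)`**.

Proof (Huybrechts, *K3*, Ch. 3 Lemma 2.7 and Cor. 3.3.6; Inose 1978 §2 for rational maps of K3
surfaces): by the tree's presentation of the transcendental lattice
(`OddPrimeSquares.exists_transcendental_subHodgeStructure`: for `h^{2,0} = 1` the rational transcendental
lattice `T(S)_ℚ = Hdg¹(S)^⊥ ⊆ H²(S(ℂ); ℚ)` underlies an IRREDUCIBLE sub-Hodge structure of `H²_B(S)`),
the rational descent of `f^*` to a morphism of Hodge structures `H²_B(X) → H²_B(Z)`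
(`KugaSatakePair.exists_hom_ofRatClass_eq₂`) restricts to a morphism `T(X)_ℚ → T(Z)_ℚ` (brick 1),
which is non-zero (`f^*` injective, `T(X)_ℚ ∋` a vector under the non-zero `(2,0)`-class) hence
SURJECTIVE by Schur's lemma for the irreducible target (`Hom.surjective_or_eq_zero`); complexify
(`KugaSatakeSelf.exists_baseChange_eq_of_transc`, `transc_of_baseChange`).

THEOREMS ONLY (no definition, no named fact, no sorry). Prover seat hodge-nonav-19652-p1 (gen 21),
`--supports stmt-HodgeConjecture-19652`. Nothing here proves an instance of the Hodge conjecture.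

References: D. Huybrechts, *Lectures on K3 Surfaces* (2016), Ch. 3 Def. 2.5, Lemma 2.7, Lemma 3.1,
Cor. 3.3.6; H. Inose, Proc. Int. Symp. Algebraic Geometry Kyoto 1977 (1978), §2; C. Voisin, *Hodge
Theory I* (2002), §7.3.1 Lemma 7.25, Cor. 7.24.
-/

set_option linter.dupNamespace false

noncomputable section

namespace Summit.HodgeConjecture.HodgeConjecture.Theorems.MarkmanPartnerTransport.FiniteMorphism

open scoped TensorProduct
open Module CategoryTheory MonoidalCategory
open Literature.AlgebraicGeometry Literature.AlgebraicGeometry.Motives Literature.AlgebraicGeometry.HodgeTheory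
open Literature.AlgebraicGeometry.Motives.HodgeStructure
open Literature.AlgebraicGeometry.Surfaces
open Literature.AlgebraicTopology.SingularHomology
open Summit.HodgeConjecture.HodgeConjecture.Theorems.OddPrimeSquares
open Summit.HodgeConjecture.HodgeConjecture.Theorems.MarkmanPartnerTransport.TranscendentalPresentation
open Summit.HodgeConjecture.HodgeConjecture.Theorems.MarkmanPartnerTransport.KugaSatakeSelf
open Summit.HodgeConjecture.HodgeConjecture.Theorems.MarkmanPartnerTransport.KugaSatakePair

variable {Z X : SchemeOver ℂ}

/-- `H²_B(S)`: the weight-two `ℚ`-Hodge structure on `H²(S(ℂ); ℚ)` of the real Hodge model of `S`. -/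
local notation3 "H²[" hS "]" =>
  bettiTwoHodgeStructure hS (BettiUniverse.realHodgeModel exists_isReal_hodgeModel_holds hS)
    (BettiUniverse.realHodgeModel_isHodgeSymmetric exists_isReal_hodgeModel_holds hS)

/-- `T(S)_ℚ = Hdg¹^⊥ ⊆ H²(S(ℂ); ℚ)`. -/
local notation3 "T[" hS "]" =>
  transcendentalLatticeBetti hS (BettiUniverse.realHodgeModel exists_isReal_hodgeModel_holds hS)
    (BettiUniverse.realHodgeModel_isHodgeSymmetric exists_isReal_hodgeModel_holds hS)

/-- `Θ : ℂ ⊗_ℚ H²(S(ℂ); ℚ) → H²(S(ℂ); ℂ)`. -/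
local notation3 "Θ[" S "]" => ofRatClassBaseChange (Motives.ComplexPoints S) (2 * 1)

/-- `ι : H²(S(ℂ); ℚ) → H²(S(ℂ); ℂ)`, the rational lattice. -/
local notation3 "ι[" S "]" => ofRatClass (Motives.ComplexPoints S) (2 * 1)

/-- `Transc[S, y]`: `y` is cup-orthogonal to `N¹(S) = algebraicClasses S 1`. Local notation only. -/
local notation3 (prettyPrint := false) "Transc[" S ", " y "]" =>
  (∀ d ∈ algebraicClasses S 1, cupProduct (rfl : 2 * 1 + 2 * 1 = 2 * 2) y d = 0)

/-- `Transc[S, y] ↔ y ∈ transcendentalSubspace S` for `S` smooth projective (bridge between the two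
currencies of the tree). [cite: Huybrechts2016K3, Ch. 3 Lemma 3.1] -/
theorem transc_iff_mem_transcendentalSubspace {S : SchemeOver ℂ} (hS : IsSmoothProjective 2 S)
    (y : complexBetti S (2 * 1)) : Transc[S, y] ↔ y ∈ transcendentalSubspace S :=
  (mem_transcendentalSubspace_iff_forall_algebraicClasses hS y).symm

/-- **`T(Z) ⊆ f^* T(X)` for surfaces of geometric genus one and `f^*` injective** (Schur's lemma on the
irreducible rational transcendental lattice of `Z`; module docstring).
[cite: Huybrechts2016K3, Ch. 3 Lemma 2.7 and Cor. 3.3.6] [cite: Inose1978, §2] -/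
theorem transcendentalSubspace_le_map_of_twoZero_lines (hZ : IsSmoothProjective 2 Z)
    (hX : IsSmoothProjective 2 X) (f : Z ⟶ X)
    (hinj : Function.Injective (complexBetti.map f (2 * 1)))
    {σZ : complexBetti Z (2 * 1)} (hσZ : IsOfHodgeType 2 Z (2 * 1) 2 0 σZ) (hσZ0 : σZ ≠ 0)
    (hlineZ : ∀ c : complexBetti Z (2 * 1), IsOfHodgeType 2 Z (2 * 1) 2 0 c → ∃ t : ℂ, c = t • σZ)
    {σX : complexBetti X (2 * 1)} (hσX : IsOfHodgeType 2 X (2 * 1) 2 0 σX) (hσX0 : σX ≠ 0)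
    (hlineX : ∀ c : complexBetti X (2 * 1), IsOfHodgeType 2 X (2 * 1) 2 0 c → ∃ t : ℂ, c = t • σX) :
    transcendentalSubspace Z ≤ (transcendentalSubspace X).map (complexBetti.map f (2 * 1)).hom := by
  classical
  -- the irreducible presentations of the two transcendental lattices
  obtain ⟨TX, hTX, -, -, -⟩ := exists_transcendental_subHodgeStructure hX hσX hσX0 hlineX
  obtain ⟨TZ, hTZ, hirrZ, -, -⟩ := exists_transcendental_subHodgeStructure hZ hσZ hσZ0 hlineZ
  -- the rational descent of `f^*` to a morphism of Hodge structures
  set ψ : complexBetti X (2 * 1) →ₗ[ℂ] complexBetti Z (2 * 1) := (complexBetti.map f (2 * 1)).hom with hψdef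
  have hψ : ∀ y, ψ y = complexBetti.map f (2 * 1) y := fun y => rfl
  obtain ⟨Ψ, hΨ⟩ := exists_hom_ofRatClass_eq₂ hX hZ ψ (fun y hy => by rw [hψ]; exact hy.map _)
    (fun i j y hy => by rw [hψ]; exact hy.map_of_isSmoothProjective hZ hX f)
  -- `Ψ` maps `T(X)_ℚ` into `T(Z)_ℚ` (brick 1)
  have hmem : ∀ t : TX.toSubmodule, (Ψ.comp TX.subtypeHom).toLinearMap t ∈ TZ.toSubmodule := by
    intro t
    have ht : (t : bettiCohomology X (2 * 1)) ∈ T[hX] := hTX ▸ t.2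
    rw [mem_transcendental_iff_transc hX, transc_iff_mem_transcendentalSubspace hX] at ht
    have h1 := map_mem_transcendentalSubspace hZ hX f ht
    rw [← hψ, ← hΨ, ← transc_iff_mem_transcendentalSubspace hZ, ← mem_transcendental_iff_transc hZ,
      ← hTZ] at h1
    rw [Hom.comp_toLinearMap, LinearMap.comp_apply, SubHodgeStructure.subtypeHom_toLinearMap,
      Submodule.subtype_apply]
    exact h1
  set ΨT : Hom TX.toHodgeStructure TZ.toHodgeStructure := (Ψ.comp TX.subtypeHom).codRestrict TZ hmem
    with hΨTdef
  have hΨT : ∀ t : TX.toSubmodule, ((ΨT.toLinearMap t : TZ.toSubmodule) : bettiCohomology Z (2 * 1)) =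
      Ψ.toLinearMap (t : bettiCohomology X (2 * 1)) := fun t => rfl
  -- `T(X)_ℚ ≠ 0`: it complexifies onto `T(X)_ℂ ∋ σX ≠ 0`
  have hne : ∃ t : TX.toSubmodule, (t : bettiCohomology X (2 * 1)) ≠ 0 := by
    by_contra hcon
    push Not at hcon
    obtain ⟨x, hx⟩ := exists_baseChange_eq_of_transc hX TX hTX (transc_of_twoZero hX hσX)
    have hsub : TX.toSubmodule.subtype = 0 := by
      ext t
      rw [Submodule.subtype_apply, hcon t, LinearMap.zero_apply]
    rw [hsub, LinearMap.baseChange_zero, LinearMap.zero_apply, map_zero] at hx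
    exact hσX0 hx.symm
  -- `ΨT ≠ 0` since `f^*` is injective
  have hΨT0 : ΨT ≠ 0 := by
    obtain ⟨t, ht⟩ := hne
    intro h0
    apply ht
    have h1 : Ψ.toLinearMap (t : bettiCohomology X (2 * 1)) = 0 := by
      rw [← hΨT, h0, Hom.zero_toLinearMap, LinearMap.zero_apply, Submodule.coe_zero]
    have h2 : ψ (ι[X] (t : bettiCohomology X (2 * 1))) = 0 := by rw [← hΨ, h1, map_zero]
    rw [hψ] at h2
    exact ofRatClass_injective (Y := Motives.ComplexPoints X) (2 * 1)
      (hinj (by rw [h2, map_zero, map_zero]))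
  -- Schur: `ΨT` is onto the irreducible `T(Z)_ℚ`
  have hsurj : Function.Surjective ΨT.toLinearMap :=
    (Hom.surjective_or_eq_zero hirrZ ΨT).resolve_right hΨT0
  have hsurjC : Function.Surjective (ΨT.toLinearMap.baseChange ℂ) := by
    rw [LinearMap.baseChange_eq_ltensor]
    exact LinearMap.lTensor_surjective ℂ hsurj
  -- complexify
  intro y hy
  rw [← transc_iff_mem_transcendentalSubspace hZ] at hy
  obtain ⟨x, hx⟩ := exists_baseChange_eq_of_transc hZ TZ hTZ hy
  obtain ⟨x', rfl⟩ := hsurjC x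
  have hcomp : TZ.toSubmodule.subtype ∘ₗ ΨT.toLinearMap = Ψ.toLinearMap ∘ₗ TX.toSubmodule.subtype := by
    ext t
    rfl
  have key : TZ.toSubmodule.subtype.baseChange ℂ (ΨT.toLinearMap.baseChange ℂ x') =
      Ψ.toLinearMap.baseChange ℂ (TX.toSubmodule.subtype.baseChange ℂ x') := by
    rw [← LinearMap.comp_apply, ← LinearMap.baseChange_comp, hcomp, LinearMap.baseChange_comp,
      LinearMap.comp_apply]
  rw [key, ofRatClassBaseChange_baseChange_eq₂ hΨ] at hx
  refine ⟨Θ[X] (TX.toSubmodule.subtype.baseChange ℂ x'), ?_, hx⟩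
  rw [SetLike.mem_coe, ← transc_iff_mem_transcendentalSubspace hX]
  exact transc_of_baseChange hX TX hTX x'

/-- **`T(Z) = f^* T(X)`** for surfaces of geometric genus one and `f^*` injective (brick 1's
`transcendentalSubspace_eq_map_of_le` with the inclusion above). [cite: Inose1978, §2]
[cite: Huybrechts2016K3, Ch. 3 Lemma 2.7 and Lemma 3.1] -/
theorem transcendentalSubspace_eq_map_of_twoZero_lines (hZ : IsSmoothProjective 2 Z)
    (hX : IsSmoothProjective 2 X) (f : Z ⟶ X)
    (hinj : Function.Injective (complexBetti.map f (2 * 1)))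
    {σZ : complexBetti Z (2 * 1)} (hσZ : IsOfHodgeType 2 Z (2 * 1) 2 0 σZ) (hσZ0 : σZ ≠ 0)
    (hlineZ : ∀ c : complexBetti Z (2 * 1), IsOfHodgeType 2 Z (2 * 1) 2 0 c → ∃ t : ℂ, c = t • σZ)
    {σX : complexBetti X (2 * 1)} (hσX : IsOfHodgeType 2 X (2 * 1) 2 0 σX) (hσX0 : σX ≠ 0)
    (hlineX : ∀ c : complexBetti X (2 * 1), IsOfHodgeType 2 X (2 * 1) 2 0 c → ∃ t : ℂ, c = t • σX) :
    transcendentalSubspace Z = (transcendentalSubspace X).map (complexBetti.map f (2 * 1)).hom :=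
  transcendentalSubspace_eq_map_of_le hZ hX f
    (transcendentalSubspace_le_map_of_twoZero_lines hZ hX f hinj hσZ hσZ0 hlineZ hσX hσX0 hlineX)

/-- **`T(Z) = f^* T(X)` in the `HasGeometricGenusOne` currency** (Morrison's `p_g = 1` surfaces).
[cite: Morrison1987Isogenies, §1 p. 182] [cite: Inose1978, §2] -/
theorem transcendentalSubspace_eq_map_of_hasGeometricGenusOne (hZ : IsSmoothProjective 2 Z)
    (hX : IsSmoothProjective 2 X) (f : Z ⟶ X)
    (hinj : Function.Injective (complexBetti.map f (2 * 1)))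
    (h1Z : HasGeometricGenusOne Z) (h1X : HasGeometricGenusOne X) :
    transcendentalSubspace Z = (transcendentalSubspace X).map (complexBetti.map f (2 * 1)).hom := by
  obtain ⟨σZ, hσZ0, hσZ, hlineZ⟩ := h1Z
  obtain ⟨σX, hσX0, hσX, hlineX⟩ := h1X
  exact transcendentalSubspace_eq_map_of_twoZero_lines hZ hX f hinj hσZ hσZ0 hlineZ hσX hσX0 hlineX

end Summit.HodgeConjecture.HodgeConjecture.Theorems.MarkmanPartnerTransport.FiniteMorphism

end
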